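import Literature.Combinatorics.SimpleGraph.HamiltonianGadgetSubstitution
import Mathlib.Algebra.BigOperators.Group.Finset.Basic
import Mathlib.Data.Set.Finite.List
import Mathlib.Data.Set.Finite.Lattice
import HarnessLib

/-!
# Gadget substitution for Hamiltonian-path counts, II: expansion and the counting identity

Continuation of `HamiltonianGadgetSubstitution.lean` (local replacement, Garey–Johnson 1979,
§3.2.2). For a gadget substitution `h : Substitution M V S GX VX M'`:

* the EXPANSION half: a Hamiltonian path of the base graph `M` using exactly the slots `U ⊆ S`,
  with a cover of the gadget realising `U` inserted at the slots (`expand (orient f)`,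
  `HamiltonianPathExpansion.lean`), is a Hamiltonian path of `M'` (`Substitution.expand_mem`),
  from which `U`, the cover and the base path are recovered (`usedSlots_expand`,
  `segFamily_expand`, `contract_expand`);
* `coverSet_finite` — the census `coverCount` is the cardinality of a finite set;
* **the counting identity** `Substitution.hamCountRF_eq_sum`:

  `hamCountRF M' (V ∪ VX) s t R F = Σ_{U ⊆ S} coverCount GX VX U * hamCountRF M V s t (R ∪ U) (F ∪ (S \ U))`

  for end points `s, t ∈ V` and constraints `R, F` on non-slot edges inside `V` — the form in
  which gadget censuses enter the count of Garey–Johnson–Tarjan 1976 / Liśkiewicz–Ogihara–Toda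
  2003, Lemma 4 ("the number of Hamiltonian paths is increased by a multiplicative factor").

## References

* M. R. Garey, D. S. Johnson, *Computers and Intractability*, Freeman 1979, §3.2.2.
* M. R. Garey, D. S. Johnson, R. E. Tarjan, SIAM J. Comput. 5 (1976) 704–714.
* M. Liśkiewicz, M. Ogihara, S. Toda, TCS 304 (2003) 129–156, §3 (proof of Lemma 4).
-/

namespace Literature.Combinatorics.SimpleGraph

open scoped Classical

variable {α : Type*} [DecidableEq α]

/-! ### A finite disjoint union -/

omit [DecidableEq α] in
/-- The cardinality of a finite disjoint union indexed by a finset. [folklore] -/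
theorem ncard_biUnion_of_disjoint {ι : Type*} [DecidableEq ι] (T : Finset ι) (A : ι → Set α)
    (hfin : ∀ i ∈ T, (A i).Finite) (hdis : ∀ i ∈ T, ∀ j ∈ T, i ≠ j → Disjoint (A i) (A j)) :
    (⋃ i ∈ T, A i).ncard = ∑ i ∈ T, (A i).ncard := by
  induction T using Finset.induction_on with
  | empty => simp
  | insert a T ha ih =>
    rw [Finset.set_biUnion_insert, Finset.sum_insert ha,
      Set.ncard_union_eq ?_ (hfin a (by simp)) ?_, ih (fun i hi => hfin i (by simp [hi]))
        (fun i hi j hj hij => hdis i (by simp [hi]) j (by simp [hj]) hij)]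
    · rw [Set.disjoint_iUnion₂_right]
      exact fun j hj => hdis a (by simp) j (by simp [hj]) (fun h => ha (h ▸ hj))
    · exact Set.Finite.biUnion' T.finite_toSet fun i hi => hfin i (by simp [Finset.mem_coe.1 hi])

/-! ### Covers form a finite set -/

/-- Lists with distinct entries inside a finite set form a finite set. [folklore] -/
theorem finite_nodup_subset_finset (VX : Finset α) : {l : List α | l.Nodup ∧ ∀ x ∈ l, x ∈ VX}.Finite := by
  have hfin : {l : List ↥VX | l.length ≤ VX.card}.Finite := List.finite_length_le _ _
  refine (hfin.image (List.map Subtype.val)).subset ?_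
  rintro l ⟨hnd, hmem⟩
  refine ⟨l.pmap (fun x hx => (⟨x, hx⟩ : ↥VX)) fun x hx => hmem x hx, ?_, ?_⟩
  · change (l.pmap _ _).length ≤ VX.card
    rw [List.length_pmap, ← List.toFinset_card_of_nodup hnd]
    exact Finset.card_le_card fun x hx => hmem x (List.mem_toFinset.1 hx)
  · rw [List.map_pmap]
    simp

/-- **The covers realising `U` form a finite set** (so `coverCount` is an honest cardinality): a
cover is determined by its strands on `U`, each a list with distinct entries inside `VX`.
[folklore] -/
theorem coverSet_finite (GX : _root_.SimpleGraph α) (VX : Finset α) (U : Finset (α × α)) :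
    (coverSet GX VX U).Finite := by
  set L : Set (List α) := {l | l.Nodup ∧ ∀ x ∈ l, x ∈ VX}
  have hL : L.Finite := finite_nodup_subset_finset VX
  let g : (α × α → List α) → (↥U → List α) := fun f e => f e
  have himg : g '' coverSet GX VX U ⊆ Set.univ.pi fun _ => L := by
    rintro _ ⟨f, hf, rfl⟩ e -
    exact ⟨(hf.1 e e.2).2.2.1, (hf.1 e e.2).2.1⟩
  refine Set.Finite.of_finite_image ((Set.Finite.pi fun _ => hL).subset himg) ?_
  intro f hf f' hf' heq
  funext e
  by_cases he : e ∈ U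
  · exact congrFun heq ⟨e, he⟩
  · rw [hf.2.1 e he, hf'.2.1 e he]

namespace Substitution

variable {M M' GX : _root_.SimpleGraph α} {V VX : Finset α} {S : Finset (α × α)}
  (h : Substitution M V S GX VX M')
include h

/-! ### The expansion of a base path by a cover -/

section expand

variable {s t : α} {U R F : Finset (α × α)} {f : α × α → List α} {l : List α}

omit h in
/-- The inserted lists lie inside the gadget. [folklore] -/
theorem orient_subset (hf : IsCover GX VX U f) (a b : α) : ∀ x ∈ orient f a b, x ∈ VX := by
  intro x hx
  rw [orient] at hx
  split_ifs at hx with hab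
  · by_cases hU : (a, b) ∈ U
    · exact (hf.1 _ hU).2.1 x hx
    · exact absurd (hf.2.1 _ hU) hab
  · by_cases hU : (b, a) ∈ U
    · exact (hf.1 _ hU).2.1 x (List.mem_reverse.1 hx)
    · rw [hf.2.1 _ hU] at hx
      simp at hx

omit h in
/-- The inserted lists have distinct entries. [folklore] -/
theorem orient_nodup (hf : IsCover GX VX U f) (a b : α) : (orient f a b).Nodup := by
  rw [orient]
  split_ifs with hab
  · by_cases hU : (a, b) ∈ U
    · exact (hf.1 _ hU).2.2.1
    · exact absurd (hf.2.1 _ hU) hab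
  · by_cases hU : (b, a) ∈ U
    · exact List.nodup_reverse.2 (hf.1 _ hU).2.2.1
    · rw [hf.2.1 _ hU]; exact List.nodup_nil

omit h in
/-- The slot responsible for a nonempty inserted list. [folklore] -/
theorem exists_slot_of_mem_orient (hf : IsCover GX VX U f) {a b x : α} (hx : x ∈ orient f a b) :
    ∃ e ∈ U, (e = (a, b) ∨ e = (b, a)) ∧ x ∈ f e := by
  rw [orient] at hx
  split_ifs at hx with hab
  · by_cases hU : (a, b) ∈ U
    · exact ⟨(a, b), hU, Or.inl rfl, hx⟩
    · exact absurd (hf.2.1 _ hU) hab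
  · by_cases hU : (b, a) ∈ U
    · exact ⟨(b, a), hU, Or.inr rfl, List.mem_reverse.1 hx⟩
    · rw [hf.2.1 _ hU] at hx
      simp at hx

omit h in
/-- A path of `M` using exactly the slots `U`: it uses a slot iff the slot is in `U`. [folklore] -/
theorem mem_U_iff_of_mem (hl : l ∈ hamSetRF M V s t (R ∪ U) (F ∪ (S \ U))) {e : α × α}
    (he : e ∈ S) : e ∈ U ↔ Uses l e := by
  constructor
  · exact fun heU => hl.2.1 e (Finset.mem_union_right _ heU)
  · intro hu
    by_contra heU
    exact hl.2.2 e (Finset.mem_union_right _ (Finset.mem_sdiff.2 ⟨he, heU⟩)) hu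

/-- **The expansion of a base path by a cover is a Hamiltonian path of `M'`** with the original
constraints. [cite: GareyJohnson1979, §3.2.2] -/
theorem expand_mem (hU : U ⊆ S) (hf : IsCover GX VX U f)
    (hR : ∀ e ∈ R, e.1 ∈ V ∧ e.2 ∈ V ∧ ¬ slotOf S e.1 e.2) (hF : ∀ e ∈ F, e.1 ∈ V ∧ e.2 ∈ V)
    (hl : l ∈ hamSetRF M V s t (R ∪ U) (F ∪ (S \ U))) :
    expand (orient f) l ∈ hamSetRF M' (V ∪ VX) s t R F := by
  obtain ⟨hham, hReq, hForb⟩ := hl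
  have hlV : ∀ x ∈ l, x ∉ VX := fun x hx => h.not_mem_VX_of_mem_V (hham.mem_iff.1 hx)
  have hι := orient_subset hf
  -- no slot of `U` is listed backwards
  have hswap : ∀ e ∈ U, (e.2, e.1) ∉ U := fun e he he' => h.not_mem_swap (hU he) (hU he')
  have hfswap : ∀ e ∈ U, f (e.2, e.1) = [] := fun e he => hf.2.1 _ (hswap e he)
  -- distinct entries
  have hnd : (expand (orient f) l).Nodup := by
    refine nodup_expand hι (orient_nodup hf) hham.1 hlV fun a b a' b' hab hab' hne _ hx hx' => ?_
    obtain ⟨e, heU, he, hxe⟩ := exists_slot_of_mem_orient hf hx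
    obtain ⟨e', heU', he', hxe'⟩ := exists_slot_of_mem_orient hf hx'
    have hee' : e = e' := by
      by_contra hee'
      exact hf.2.2.1 e heU e' heU' hee' hxe hxe'
    subst hee'
    -- then `{a, b} = {a', b'}`; the pairs being different, `l` would traverse the edge both ways
    rcases he with rfl | rfl <;> rcases he' with h1 | h1 <;> simp only [Prod.mk.injEq] at h1 <;>
      obtain ⟨rfl, rfl⟩ := h1
    · exact hne rfl
    · exact not_infix_swap_of_nodup hham.1 hab hab'
    · exact not_infix_swap_of_nodup hham.1 hab hab'
    · exact hne rfl
  refine ⟨⟨hnd, ?_, by rw [head?_expand, hham.2.2.1], by rw [getLast?_expand, hham.2.2.2.1], ?_⟩, ?_, ?_⟩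
  · -- support `V ∪ VX`
    ext x
    rw [List.mem_toFinset, mem_expand_iff, Finset.mem_union]
    constructor
    · rintro (hx | ⟨a, b, -, hx⟩)
      · exact Or.inl (hham.mem_iff.1 hx)
      · exact Or.inr (hι a b x hx)
    · rintro (hx | hx)
      · exact Or.inl (hham.mem_iff.2 hx)
      · obtain ⟨e, heU, hxe⟩ := hf.2.2.2 x hx
        have hne : f e ≠ [] := List.ne_nil_of_mem hxe
        rcases hReq e (Finset.mem_union_right _ heU) with hinf | hinf
        · exact Or.inr ⟨e.1, e.2, hinf, by rw [orient, if_pos hne]; exact hxe⟩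
        · refine Or.inr ⟨e.2, e.1, hinf, ?_⟩
          rw [orient, hfswap e heU, if_neg (by simp)]
          exact List.mem_reverse.2 hxe
  · -- consecutive entries are adjacent in `M'`
    refine isChain_expand _ fun a b hab => ?_
    have hadj : M.Adj a b := hham.adj_of_uses (e := (a, b)) (Or.inl hab)
    have ha : a ∈ V := hham.mem_iff.1 (hab.subset (by simp))
    have hb : b ∈ V := hham.mem_iff.1 (hab.subset (by simp))
    by_cases h1 : f (a, b) ≠ []
    · have hU1 : (a, b) ∈ U := by by_contra hc; exact h1 (hf.2.1 _ hc)
      rw [orient, if_pos h1]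
      exact ((hf.1 _ hU1).2.2.2).imp fun x y hxy => (h.adj' x y).2 (Or.inr hxy)
    · rw [orient, if_neg h1]
      by_cases h2 : f (b, a) ≠ []
      · have hU2 : (b, a) ∈ U := by by_contra hc; exact h2 (hf.2.1 _ hc)
        exact ((hf.1 _ hU2).reverse.2.2.2).imp fun x y hxy => (h.adj' x y).2 (Or.inr hxy)
      · simp only [ne_eq, Decidable.not_not] at h2
        rw [h2, List.reverse_nil]
        refine List.IsChain.cons_cons ((h.adj' a b).2 (Or.inl ⟨hadj, ha, hb, fun hsl => ?_⟩)) (List.isChain_singleton b)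
        rcases hsl with he | he
        · have : (a, b) ∈ U := (mem_U_iff_of_mem ⟨hham, hReq, hForb⟩ he).2 (Or.inl hab)
          exact h1 (hf.1 _ this).1
        · have : (b, a) ∈ U := (mem_U_iff_of_mem ⟨hham, hReq, hForb⟩ he).2 (Or.inr hab)
          exact (hf.1 _ this).1 h2
  · -- required edges
    intro e he
    obtain ⟨h1, h2, hsl⟩ := hR e he
    have hz : ∀ p q, ¬ slotOf S p q → orient f p q = [] := fun p q hpq => by
      have e1 : f (p, q) = [] := hf.2.1 _ fun hc => hpq (Or.inl (hU hc))
      have e2 : f (q, p) = [] := hf.2.1 _ fun hc => hpq (Or.inr (hU hc))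
      rw [orient, e1, if_neg (by simp), e2, List.reverse_nil]
    rcases hReq e (Finset.mem_union_left _ he) with hinf | hinf
    · obtain ⟨E₁, E₂, hE, -⟩ := expand_eq_append_of_infix (orient f) hinf
      rw [hz _ _ hsl, List.nil_append] at hE
      exact Or.inl ⟨E₁, E₂, by rw [hE]; simp⟩
    · obtain ⟨E₁, E₂, hE, -⟩ := expand_eq_append_of_infix (orient f) hinf
      rw [hz _ _ (fun hs' => hsl (slotOf_comm.1 hs')), List.nil_append] at hE
      exact Or.inr ⟨E₁, E₂, by rw [hE]; simp⟩
  · -- forbidden edges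
    intro e he hu
    obtain ⟨h1, h2⟩ := hF e he
    have hX1 := h.not_mem_VX_of_mem_V h1
    have hX2 := h.not_mem_VX_of_mem_V h2
    rcases hu with hinf | hinf
    · exact hForb e (Finset.mem_union_left _ he) (Or.inl (infix_of_infix_expand hι hlV hinf hX1 hX2))
    · exact hForb e (Finset.mem_union_left _ he) (Or.inr (infix_of_infix_expand hι hlV hinf hX2 hX1))

/-- **Recovering the base path**: the contraction of the expansion. [folklore] -/
theorem contract_expand_orient (hf : IsCover GX VX U f) (hl : l ∈ hamSetRF M V s t (R ∪ U) (F ∪ (S \ U))) :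
    contract VX (expand (orient f) l) = l :=
  contract_expand (orient_subset hf) fun _ hx => h.not_mem_VX_of_mem_V (hl.1.mem_iff.1 hx)

/-- **Recovering the realised slots**: the expansion uses exactly the slots of `U`. [folklore] -/
theorem usedSlots_expand (hU : U ⊆ S) (hf : IsCover GX VX U f)
    (hl : l ∈ hamSetRF M V s t (R ∪ U) (F ∪ (S \ U))) : usedSlots S VX (expand (orient f) l) = U := by
  ext e
  rw [usedSlots, Finset.mem_filter, h.contract_expand_orient hf hl]
  constructor
  · rintro ⟨he, hu⟩
    exact (mem_U_iff_of_mem hl he).2 hu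
  · intro he
    exact ⟨hU he, (mem_U_iff_of_mem hl (hU he)).1 he⟩

/-- **Recovering the cover**: the traversal family of the expansion is the inserted cover.
[folklore] -/
theorem segFamily_expand (hU : U ⊆ S) (hf : IsCover GX VX U f)
    (hR : ∀ e ∈ R, e.1 ∈ V ∧ e.2 ∈ V ∧ ¬ slotOf S e.1 e.2) (hF : ∀ e ∈ F, e.1 ∈ V ∧ e.2 ∈ V)
    (hl : l ∈ hamSetRF M V s t (R ∪ U) (F ∪ (S \ U))) : segFamily S VX (expand (orient f) l) = f := by
  have hl' := h.expand_mem hU hf hR hF hl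
  have hlV : ∀ x ∈ l, x ∉ VX := fun x hx => h.not_mem_VX_of_mem_V (hl.1.mem_iff.1 hx)
  have hswap : ∀ e ∈ U, f (e.2, e.1) = [] := fun e he => hf.2.1 _ fun he' => h.not_mem_swap (hU he) (hU he')
  funext e
  by_cases heU : e ∈ U
  · have hne : f e ≠ [] := (hf.1 e heU).1
    rcases hl.2.1 e (Finset.mem_union_right _ heU) with hinf | hinf
    · have hseg : IsSeg VX (expand (orient f) l) e.1 (f e) e.2 :=
        (isSeg_expand_iff (orient_subset hf) hlV hl'.1.1).2 ⟨hinf, by rw [orient, if_pos hne], hne⟩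
      exact segFamily_of_isSeg hl'.1 (hU heU) hseg
    · have hseg : IsSeg VX (expand (orient f) l) e.2 (f e).reverse e.1 := by
        refine (isSeg_expand_iff (orient_subset hf) hlV hl'.1.1).2 ⟨hinf, ?_, by simpa using hne⟩
        rw [orient, hswap e heU, if_neg (by simp)]
      rw [h.segFamily_of_isSeg_swap hl'.1 (hU heU) hseg, List.reverse_reverse]
  · rw [hf.2.1 e heU]
    refine h.segFamily_of_not_mem hl'.1 ?_
    rw [h.usedSlots_expand hU hf hl]
    exact heU

end expand

/-! ### The counting identity -/

/-- **Gadget substitution for Hamiltonian-path counts** (local replacement, counting form): with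
end points in `V` and constraints on non-slot edges inside `V`,
`#Ham(M', R, F) = Σ_{U ⊆ S} N(U) · #Ham(M, R ∪ U, F ∪ (S \ U))`, the census `N(U) = coverCount GX VX U`
of the gadget weighting the base paths that use exactly the slots `U`.
[cite: GareyJohnson1979, §3.2.2 (local replacement)] -/
theorem hamCountRF_eq_sum {s t : α} (hsV : s ∈ V) (htV : t ∈ V) {R F : Finset (α × α)}
    (hR : ∀ e ∈ R, e.1 ∈ V ∧ e.2 ∈ V ∧ ¬ slotOf S e.1 e.2)
    (hF : ∀ e ∈ F, e.1 ∈ V ∧ e.2 ∈ V ∧ ¬ slotOf S e.1 e.2) :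
    hamCountRF M' (V ∪ VX) s t R F =
      ∑ U ∈ S.powerset, coverCount GX VX U * hamCountRF M V s t (R ∪ U) (F ∪ (S \ U)) := by
  have hF' : ∀ e ∈ F, e.1 ∈ V ∧ e.2 ∈ V := fun e he => ⟨(hF e he).1, (hF e he).2.1⟩
  have hR' : ∀ e ∈ R, e.1 ∈ V ∧ e.2 ∈ V := fun e he => ⟨(hR e he).1, (hR e he).2.1⟩
  -- the pieces of the partition and the gluing map
  set A := hamSetRF M' (V ∪ VX) s t R F with hA
  set B : Finset (α × α) → Set ((α × α → List α) × List α) := fun U =>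
    coverSet GX VX U ×ˢ hamSetRF M V s t (R ∪ U) (F ∪ (S \ U)) with hB
  set Ψ : (α × α → List α) × List α → List α := fun p => expand (orient p.1) p.2 with hΨ
  have himg : ∀ U ∈ S.powerset, Ψ '' B U ⊆ A := by
    rintro U hU _ ⟨⟨f, l⟩, ⟨hf, hl⟩, rfl⟩
    exact h.expand_mem (Finset.mem_powerset.1 hU) hf hR hF' hl
  have hinj : ∀ U ∈ S.powerset, Set.InjOn Ψ (B U) := by
    rintro U hU ⟨f, l⟩ ⟨hf, hl⟩ ⟨f', l'⟩ ⟨hf', hl'⟩ heq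
    have hU' := Finset.mem_powerset.1 hU
    dsimp only at hf hl hf' hl'
    simp only [hΨ] at heq
    have h1 : l = l' := by
      rw [← h.contract_expand_orient hf hl, ← h.contract_expand_orient hf' hl', heq]
    have h2 : f = f' := by
      rw [← h.segFamily_expand hU' hf hR hF' hl, ← h.segFamily_expand hU' hf' hR hF' hl', heq]
    rw [h1, h2]
  have hused : ∀ U ∈ S.powerset, ∀ l' ∈ Ψ '' B U, usedSlots S VX l' = U := by
    rintro U hU _ ⟨⟨f, l⟩, ⟨hf, hl⟩, rfl⟩
    exact h.usedSlots_expand (Finset.mem_powerset.1 hU) hf hl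
  have hcover : A = ⋃ U ∈ S.powerset, Ψ '' B U := by
    ext l'
    simp only [Set.mem_iUnion]
    constructor
    · intro hl'
      refine ⟨usedSlots S VX l', Finset.mem_powerset.2 (usedSlots_subset l'),
        ⟨(segFamily S VX l', contract VX l'), ⟨h.segFamily_isCover hsV htV hl'.1,
          h.contract_mem hsV htV hR' (fun e he => (hF e he).2.2) hl'⟩, ?_⟩⟩
      exact h.expand_segFamily_contract hsV htV hl'.1
    · rintro ⟨U, hU, hl'⟩
      exact himg U hU hl'
  have hdis : ∀ U ∈ S.powerset, ∀ U' ∈ S.powerset, U ≠ U' → Disjoint (Ψ '' B U) (Ψ '' B U') := by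
    intro U hU U' hU' hne
    rw [Set.disjoint_left]
    intro l' h1 h2
    exact hne ((hused U hU l' h1).symm.trans (hused U' hU' l' h2))
  have hfin : ∀ U ∈ S.powerset, (Ψ '' B U).Finite := fun U hU =>
    (hamSetRF_finite M' (V ∪ VX) s t R F).subset (himg U hU)
  calc hamCountRF M' (V ∪ VX) s t R F = A.ncard := rfl
    _ = (⋃ U ∈ S.powerset, Ψ '' B U).ncard := by rw [hcover]
    _ = ∑ U ∈ S.powerset, (Ψ '' B U).ncard := ncard_biUnion_of_disjoint _ _ hfin hdis
    _ = ∑ U ∈ S.powerset, (B U).ncard := Finset.sum_congr rfl fun U hU => (hinj U hU).ncard_image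
    _ = ∑ U ∈ S.powerset, coverCount GX VX U * hamCountRF M V s t (R ∪ U) (F ∪ (S \ U)) :=
      Finset.sum_congr rfl fun U _ => Set.ncard_prod

/-- The unconstrained form: `#Ham(M') = Σ_{U ⊆ S} N(U) · #Ham(M, U required, S \ U forbidden)`.
[cite: GareyJohnson1979, §3.2.2 (local replacement)] -/
theorem hamCount_eq_sum {s t : α} (hsV : s ∈ V) (htV : t ∈ V) :
    hamCount M' (V ∪ VX) s t = ∑ U ∈ S.powerset, coverCount GX VX U * hamCountRF M V s t U (S \ U) := by
  rw [hamCount_eq, h.hamCountRF_eq_sum hsV htV (by simp) (by simp)]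
  simp

end Substitution

end Literature.Combinatorics.SimpleGraph
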